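import Mathlib.RingTheory.Regular.RegularSequence
import Mathlib.RingTheory.Flat.Basic
import Mathlib.RingTheory.TensorProduct.Quotient
import Mathlib.RingTheory.SimpleModule.Basic
import Mathlib.RingTheory.Length
import Literature.RingTheory.HilbertSamuel.LocalRing
import HarnessLib

/-!
# Regular sequences on the fibre extend to `B ⊗_A N` for flat `B` and `N` of finite length
# (the regular-sequence input of CJS 2020, Lemma 2.27 (2) / Bennett–Singh–Hironaka's lemma)

Topic: `Literature/RingTheory/Flat`. Let `(A, 𝔪) → B` be an algebra which is flat over the local
ring `A`, and let `y₁, …, y_d ∈ B` be a weakly regular sequence on the fibre `B̄ = B/𝔪B`. Then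
`y` is a weakly regular sequence on `B ⊗_A N` for every `A`-module `N` of finite length, in
particular on all `B/𝔪ⁱB` (Matsumura, *Commutative Ring Theory*, §22, the principle behind
Thm. 22.5 and its Corollary: "`B̄`-regular ⇒ `B ⊗ N`-regular for `N` of finite length", by
induction on the length through the exact sequences `0 → B ⊗ N' → B ⊗ N → B ⊗ k → 0` given by
flatness). This is the regular-sequence input of the computation of Hilbert functions under flat
local homomorphisms with regular fibre (Cossart–Jannsen–Saito 2020, Lemma 2.27 (2), (2.5)–(2.6);
Lemma 2.37 (1)), see `FlatRegularFibreHilbert.lean`.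

PROVED here (no definitions, no named facts):

* `isWeaklyRegular_of_subsingleton` — every sequence is weakly regular on the zero module;
* `isWeaklyRegular_of_exact` — **weakly regular sequences are stable under extensions**: for a
  short exact sequence `0 → M' → M → M'' → 0`, a sequence weakly regular on `M'` and on `M''` is
  weakly regular on `M` (Mathlib supplies the exactness of `0 → M'/rM' → M/rM → M''/rM'' → 0`
  when `r` is `M''`-regular, `QuotSMulTop.map_first_exact_on_four_term_exact_of_isSMulRegular_last`);
* `isWeaklyRegular_baseChange_of_length_ne_top` — the statement above;
* `isWeaklyRegular_quotient_map_pow_maximalIdeal` — `y` is weakly regular on `B/𝔪ⁱB` for all `i`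
  (`A` Noetherian local).

## Sources

* H. Matsumura, *Commutative Ring Theory*, CUP 1986, §22 (Thm. 22.5 and Corollary, p. 177).
  [Matsumura1987]
* V. Cossart, U. Jannsen, S. Saito, LNM 2270 (2020), Lemma 2.27 (2). [CossartJannsenSaito2020]
-/

noncomputable section

open RingTheory.Sequence TensorProduct IsLocalRing Function

namespace Literature.RingTheory.Flat

universe u v w

section Extension

variable {R : Type u} [CommRing R]

/-- Every sequence is weakly regular on a trivial module. [folklore] -/
theorem isWeaklyRegular_of_subsingleton {M : Type v} [AddCommGroup M] [Module R M]
    [Subsingleton M] (rs : List R) : IsWeaklyRegular M rs := by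
  induction rs generalizing M with
  | nil => exact IsWeaklyRegular.nil R M
  | cons r rs ih =>
    refine IsWeaklyRegular.cons (fun a b _ => Subsingleton.elim a b) ?_
    haveI : Subsingleton (QuotSMulTop r M) :=
      Submodule.Quotient.subsingleton_iff.mpr (Subsingleton.elim _ _)
    exact ih

/-- **Weakly regular sequences are stable under extensions**: if `0 → M' → M → M'' → 0` is exact
and `rs` is weakly regular on `M'` and on `M''`, then `rs` is weakly regular on `M`.
[cite: Matsumura1987, §22 (proof of Thm. 22.5)] -/
theorem isWeaklyRegular_of_exact {M' : Type v} {M : Type v} {M'' : Type v} [AddCommGroup M']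
    [AddCommGroup M] [AddCommGroup M''] [Module R M'] [Module R M] [Module R M'']
    (f : M' →ₗ[R] M) (g : M →ₗ[R] M'') (hf : Injective f) (hfg : Exact f g) (hg : Surjective g)
    {rs : List R} (h' : IsWeaklyRegular M' rs) (h'' : IsWeaklyRegular M'' rs) :
    IsWeaklyRegular M rs := by
  induction rs generalizing M' M M'' with
  | nil => exact IsWeaklyRegular.nil R M
  | cons r rs ih =>
    rw [isWeaklyRegular_cons_iff] at h' h'' ⊢
    obtain ⟨h'1, h'2⟩ := h'
    obtain ⟨h''1, h''2⟩ := h''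
    -- `r` is `M`-regular
    have h1 : IsSMulRegular M r := by
      intro a b hab
      have hab' : r • a = r • b := hab
      have hg' : g a = g b := h''1 (by
        change r • g a = r • g b
        rw [← map_smul, ← map_smul, hab'])
      have hker : a - b ∈ LinearMap.ker g := by
        rw [LinearMap.mem_ker, map_sub, hg', sub_self]
      rw [hfg.linearMap_ker_eq] at hker
      obtain ⟨c, hc⟩ := hker
      have hrc : f (r • c) = 0 := by rw [map_smul, hc, smul_sub, hab', sub_self]
      have hc0 : r • c = 0 := hf (by rw [hrc, map_zero])
      have : c = 0 := h'1 (by change r • c = r • 0; rw [hc0, smul_zero])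
      rw [this, map_zero] at hc
      exact sub_eq_zero.mp hc.symm
    refine ⟨h1, ?_⟩
    -- the sequence `0 → M'/rM' → M/rM → M''/rM'' → 0`
    have hexact : Exact (QuotSMulTop.map r f) (QuotSMulTop.map r g) := QuotSMulTop.map_exact r hfg hg
    have hsurj : Surjective (QuotSMulTop.map r g) := QuotSMulTop.map_surjective r hg
    have hinj : Injective (QuotSMulTop.map r f) := by
      have h0 : Exact (0 : PUnit.{v + 1} →ₗ[R] M') f := by
        intro x
        constructor
        · intro hx
          have hx0 : x = 0 := hf (hx.trans (map_zero f).symm)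
          exact ⟨PUnit.unit, by rw [hx0, LinearMap.zero_apply]⟩
        · rintro ⟨y, rfl⟩
          rw [LinearMap.zero_apply, map_zero]
      have key := QuotSMulTop.map_first_exact_on_four_term_exact_of_isSMulRegular_last h0 hfg h''1
      intro a b hab
      rw [← sub_eq_zero, ← map_sub] at hab
      have := (key _).mp hab
      obtain ⟨y, hy⟩ := this
      rw [← sub_eq_zero, ← hy]
      simp [QuotSMulTop.map]
    exact ih (QuotSMulTop.map r f) (QuotSMulTop.map r g) hinj hexact hsurj h'2 h''2

end Extension

/-! ## Base change of a regular sequence on the fibre -/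

section BaseChange

variable {A : Type u} [CommRing A] [IsLocalRing A] {B : Type u} [CommRing B] [Algebra A B]
  [Module.Flat A B]

/-- **A weakly regular sequence on the fibre `B̄ = B/𝔪B` is weakly regular on `B ⊗_A N` for every
`A`-module `N` of finite length** (`B` flat over the local ring `A`): induction on the length of
`N` through a maximal submodule `N' ⊊ N` (`N/N' ≅ k`, `B ⊗ k = B̄`), flatness making
`0 → B ⊗ N' → B ⊗ N → B ⊗ (N/N') → 0` exact.
[cite: Matsumura1987, §22 (Thm. 22.5 and Corollary)] -/
theorem isWeaklyRegular_baseChange_of_length_ne_top {ys : List B}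
    (hys : IsWeaklyRegular (B ⧸ (maximalIdeal A).map (algebraMap A B)) ys) :
    ∀ (n : ℕ) (N : Type u) [AddCommGroup N] [Module A N], Module.length A N = n →
      IsWeaklyRegular (B ⊗[A] N) ys := by
  intro n
  induction n using Nat.strong_induction_on with
  | _ n ih =>
    intro N _ _ hn
    by_cases hN : Subsingleton N
    · haveI : Subsingleton (B ⊗[A] N) := by
        refine ⟨fun a b => ?_⟩
        have : ∀ x : B ⊗[A] N, x = 0 := fun x => by
          induction x using TensorProduct.induction_on with
          | zero => rfl
          | tmul b m => rw [Subsingleton.elim m 0, tmul_zero]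
          | add x y hx hy => rw [hx, hy, add_zero]
        rw [this a, this b]
      exact isWeaklyRegular_of_subsingleton ys
    · rw [not_subsingleton_iff_nontrivial] at hN
      -- `N` has finite length: Noetherian (hence finitely generated), so a maximal submodule exists
      have hfl : IsFiniteLength A N := Module.length_ne_top_iff.mp (by rw [hn]; exact ENat.coe_ne_top n)
      haveI : IsNoetherian A N := (isFiniteLength_iff_isNoetherian_isArtinian.mp hfl).1
      obtain ⟨N', hN', -⟩ := (eq_top_or_exists_le_coatom (⊥ : Submodule A N)).resolve_left bot_ne_top
      -- `N/N' ≅ k`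
      haveI : IsSimpleModule A (N ⧸ N') := isSimpleModule_iff_isCoatom.mpr hN'
      obtain ⟨I, hI, ⟨e⟩⟩ := isSimpleModule_iff_quot_maximal.mp ‹IsSimpleModule A (N ⧸ N')›
      have hIm : I = maximalIdeal A := IsLocalRing.eq_maximalIdeal hI
      subst hIm
      -- lengths
      have hlen : Module.length A N = Module.length A N' + Module.length A (N ⧸ N') :=
        Module.length_eq_add_of_exact N'.subtype N'.mkQ N'.injective_subtype N'.mkQ_surjective
          (LinearMap.exact_subtype_mkQ N')
      have hlen1 : Module.length A (N ⧸ N') = 1 := Module.length_eq_one_iff.mpr inferInstance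
      have hN'len : ∃ m : ℕ, Module.length A N' = m ∧ m < n := by
        have hfin : Module.length A N' ≠ ⊤ := by
          intro h; rw [h, top_add] at hlen; rw [hn] at hlen; exact ENat.coe_ne_top n hlen
        obtain ⟨m, hm⟩ := ENat.ne_top_iff_exists.mp hfin
        refine ⟨m, hm.symm, ?_⟩
        rw [← hm, hlen1, hn] at hlen
        have : (n : ℕ∞) = (m + 1 : ℕ) := by rw [hlen]; push_cast; rfl
        have := ENat.coe_inj.mp this
        omega
      obtain ⟨m, hm, hmn⟩ := hN'len
      have h' : IsWeaklyRegular (B ⊗[A] N') ys := ih m hmn N' hm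
      -- `B ⊗ (N/N') ≅ B ⊗ k ≅ B/𝔪B`
      have h'' : IsWeaklyRegular (B ⊗[A] (N ⧸ N')) ys := by
        let e₁ : B ⊗[A] (N ⧸ N') ≃ₗ[B] B ⊗[A] (A ⧸ maximalIdeal A) :=
          e.baseChange A B (N ⧸ N') (A ⧸ maximalIdeal A)
        let e₂ : (B ⧸ (maximalIdeal A).map (algebraMap A B)) ≃ₗ[B] B ⊗[A] (A ⧸ maximalIdeal A) :=
          (Algebra.TensorProduct.quotIdealMapEquivTensorQuot B (maximalIdeal A)).toLinearEquiv
        exact (e₁.trans e₂.symm).isWeaklyRegular_congr ys |>.mpr hys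
      -- the exact sequence `0 → B ⊗ N' → B ⊗ N → B ⊗ (N/N') → 0`
      refine isWeaklyRegular_of_exact ((N'.subtype).baseChange B) ((N'.mkQ).baseChange B) ?_ ?_ ?_ h' h''
      · exact Module.Flat.lTensor_preserves_injective_linearMap _ N'.injective_subtype
      · exact lTensor_exact B (LinearMap.exact_subtype_mkQ N') N'.mkQ_surjective
      · exact LinearMap.lTensor_surjective B N'.mkQ_surjective

/-- In particular **`y` is weakly regular on `B/𝔪ⁱB` for all `i`** when `A` is a Noetherian local
ring. [cite: Matsumura1987, §22 (Thm. 22.5 and Corollary)] -/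
theorem isWeaklyRegular_quotient_map_pow_maximalIdeal [IsNoetherianRing A] {ys : List B}
    (hys : IsWeaklyRegular (B ⧸ (maximalIdeal A).map (algebraMap A B)) ys) (i : ℕ) :
    IsWeaklyRegular (B ⧸ (maximalIdeal A ^ i).map (algebraMap A B)) ys := by
  have hfin : Module.length A (A ⧸ maximalIdeal A ^ i) ≠ ⊤ := by
    cases i with
    | zero =>
      rw [pow_zero, Ideal.one_eq_top]
      haveI : Subsingleton (A ⧸ (⊤ : Ideal A)) := Ideal.Quotient.subsingleton_iff.mpr rfl
      rw [Module.length_eq_zero]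
      exact ENat.zero_ne_top
    | succ n =>
      rw [← Literature.RingTheory.HilbertSamuel.sum_hilbertFun_eq_length]
      exact ENat.coe_ne_top _
  obtain ⟨n, hn⟩ := ENat.ne_top_iff_exists.mp hfin
  have h := isWeaklyRegular_baseChange_of_length_ne_top hys n (A ⧸ maximalIdeal A ^ i) hn.symm
  exact ((Algebra.TensorProduct.quotIdealMapEquivTensorQuot B (maximalIdeal A ^ i)).toLinearEquiv
    |>.isWeaklyRegular_congr ys).mpr h

end BaseChange

end Literature.RingTheory.Flat
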